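import Literature.MathematicalPhysics.QuantumFieldTheory.Chatterjee2019LargeN.CoeffCatalanBound
import Literature.MathematicalPhysics.QuantumFieldTheory.Chatterjee2019LargeN.RealAnalyticity
import Literature.MathematicalPhysics.QuantumFieldTheory.Chatterjee2019LargeN.MasterLoopConvergence
import Mathlib.Analysis.Normed.Ring.InfiniteSum
import HarnessLib

/-!
# Chatterjee 2019, Corollary 3.2 (factorization of Wilson loops) from Theorem 3.1 — §13 in coefficient form, PROVED

S. Chatterjee, *Rigorous solution of strongly coupled `SO(N)` lattice gauge theory in the large `N` limit*,
Comm. Math. Phys. **366** (2019) 203–268 (arXiv:1502.07719), **Corollary 3.2**: «Let all notation be as in Theorem 3.1,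
and suppose that `|β| ≤ β₀(d)`. Then for any non-null loops `l₁, …, lₙ`,
`lim_{N→∞} ⟨W_{l₁} W_{l₂} ⋯ W_{lₙ}⟩_{Λ_N,N,β}/Nⁿ = lim_{N→∞} Πᵢ ⟨W_{lᵢ}⟩_{Λ_N,N,β}/N`», and its proof in **§13** (held text
`paper:arxiv-1502.07719`, chunks `p0032`–`p0033`): Lemma 13.2 (for positive `a₀, …, a_{n−1}`, `b₀, …, b_{m−1}`,
`a_n = b_m = 0`: `Σ_{α∈𝒜(n,m)} Π_i 1/(a_{α(i)} + b_{i−α(i)}) = 1/(a₀⋯a_{n−1} b₀⋯b_{m−1})`), Lemma 13.3 (every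
`Y ∈ 𝒳(l, l')` is uniquely a merging `α(X, X')` of `X ∈ 𝒳(l)`, `X' ∈ 𝒳(l')`: «Since loops are not allowed to merge in a
trajectory … any component of `Y` is a loop sequence of the form `(s, s')` … either `s_{i+1}` is a deformation or
splitting of `s_i` and `s'_{i+1} = s'_i`, or …»), whence `Σ_{𝒳(l,l')} w_β = Σ_{𝒳(l)} w_β · Σ_{𝒳(l')} w_β`.

THEOREMS ONLY (no definitions, no new `Prop` fact; net Literature debt `0`, and the named fact `WilsonLoopFactorization` of
`StrongCoupling` now follows from `GaugeStringDuality`):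
* ★ `Factorization.coeffA_append` — the coefficient (`β`-expanded) form of §13, HYPOTHESIS-FREE:
  `a_k(s₁, s₂) = Σ_{k₁+k₂=k} a_{k₁}(s₁) a_{k₂}(s₂)` for lists `s₁, s₂` of non-null loops (`a_k` = the trajectory-sum
  coefficients `coeffA` of Corollary 3.5).
* `Factorization.tsum_coeffA_mul_pow_eq_prod` — `Σ_k a_k(l₁,…,lₙ) β^k = Πᵢ Σ_k a_k(lᵢ) β^k` under absolute convergence.
* ★ `wilsonLoopFactorization_of_gaugeStringDuality : GaugeStringDuality d → WilsonLoopFactorization d` (Corollary 3.2 ⇐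
  Theorem 3.1, with Corollary 3.5 = `RealAnalyticity.hasSum_coeffA_mul_pow` and Lemma 10.1 =
  `CoeffCatalanBound.coeffA_mul_pow_summable_abs` for the absolute convergence at `|β| ≤ 1/(2K⁵)`).
* (v1.2) `coeffA_eq_zero_of_lt_length` — `a_k(l₁, …, lₙ) = 0` for `k < n` (Lemma 11.3 through `coeffA_append`).
* (v1.3) `length_mul_coeffA_singleton_one` — `|l|·a₁((l)) = #{null l ⊖ₓ p} − #{null l ⊕ₓ p}` over `𝔻((l))` (Corollary 10.4
  at `k = 1` with Lemma 11.3; the combinatorial content of §4's «a₁ = 1» for the plaquette).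
* (v1.1) ★ `wilsonLoopVar_tendsto_in_measure` — the «in particular» clause of Corollary 3.2: `W_l/N → lim ⟨W_l⟩/N` in
  probability (`μ_{Λ_N,N,β}{|W_l/N − L| ≥ ε} → 0`), by Chebyshev from the factorization at `s = (l, l)`; with the
  measurability/integrability of `W_l` (`measurable_wilsonLoopVar`, `integrable_wilsonLoopVar`) and
  `⟨(W_l/N − L)²⟩ = φ((l,l)) − 2Lφ((l)) + L²` (`integral_sq_sub_eq`).

## How the printed proof is followed, and the one deviation
The tree's trajectories are sequences of MOVES (`LatticeStrings.Trajectory`), each acting on one component; for a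
concatenation `(s₁, s₂)` a move acts inside one block and leaves the other untouched (`replaceAt_append_left/right`,
`sum_sameIdx_append`, `sum_invIdx_append`, `sum_deformIdx_append`) — this is Lemma 13.3's dichotomy.  Its weight is
`∓1/|s| = (|s₁|/|s|)·(∓1/|s₁|)` resp. `(|s₂|/|s|)·(∓1/|s₂|)`; Lemma 13.2 is exactly the statement that these ratios sum to
`1` over all interleavings.  DEVIATION (shorter road, same content): instead of the interleaving bijection on whole
trajectories and Lemma 13.2 for the product of weights, we run the nested induction on `(k, ι(s))` of §§10–12 with the
first-move recursion for every `k` (`len_mul_coeffA`, the tree's form of Corollary 10.4 including `k = 0`): one step of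
the recursion for `(s₁, s₂)` splits into the two blocks, the induction hypothesis applies to the results, and the identity
`|s₁| + |s₂| = |s|` (the one-step case of Lemma 13.2) closes the induction.  The analytic step is the Cauchy product of
absolutely convergent series (Mathlib `tsum_mul_tsum_eq_tsum_sum_antidiagonal_of_summable_norm`).

## WHAT THIS IS NOT
Theorem 3.1 (`GaugeStringDuality`) remains a named fact; nothing here bears on four-dimensional Yang–Mills or a mass gap.

## References
* S. Chatterjee, Comm. Math. Phys. **366** (2019) 203–268, doi:10.1007/s00220-019-03353-3, arXiv:1502.07719 —
  Corollary 3.2, §13 (Lemmas 13.1–13.3 and the proof of Corollary 3.2), Corollary 3.5, Corollary 10.4, Lemma 10.1.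
  [Chatterjee2019LargeN]
-/

noncomputable section

open Finset Filter Topology
open Literature.Probability.LatticeModels Literature.MathematicalPhysics.QuantumLattice

namespace Literature.MathematicalPhysics.QuantumFieldTheory.Chatterjee2019LargeN

variable {d : ℕ}

namespace Factorization

open CoeffCatalanBoundProof

/-! ### The first-move recursion for `a_k(s)` (all `k`, any non-null list) -/

/-- The signed fibre sum over `{X' : δ(s,s') + δ(X') = k}` is `a_{k−δ(s,s')}(s')` (zero unless `δ(s,s') ≤ k`).
[cite: Chatterjee2019LargeN, §12 (proof of (12.1): «any X ∈ 𝒳ₖ(s) may either be obtained uniquely as (s, X') …»)] -/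
theorem fibre_sum_eq {s : LoopSeq d} (m : Move s) (k : ℕ)
    [Fintype {Y : Trajectory m.result // m.dcount + Y.numDeform = k}] :
    ∑ Y : {Y : Trajectory m.result // m.dcount + Y.numDeform = k}, Y.1.vweight =
      if m.dcount ≤ k then coeffA m.result (k - m.dcount) else 0 := by
  classical
  split_ifs with h
  · haveI : Fintype (TrajectoryWith m.result (k - m.dcount)) :=
      @Fintype.ofFinite _ (finite_trajectoryWith m.result (k - m.dcount))
    rw [coeffA, tsum_fintype]
    let e : {Y : Trajectory m.result // m.dcount + Y.numDeform = k} ≃ TrajectoryWith m.result (k - m.dcount) :=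
      Equiv.subtypeEquivRight fun Y => by constructor <;> intro hY <;> omega
    rw [← e.symm.sum_comp]
    exact Finset.sum_congr rfl fun Y _ => rfl
  · have : IsEmpty {Y : Trajectory m.result // m.dcount + Y.numDeform = k} :=
      ⟨fun Y => h (by have := Y.2; omega)⟩
    rw [Fintype.sum_empty]

/-- **First-move recursion for the trajectory-sum coefficients, every `k`** (Corollary 10.4 in the tree's reading, with the
`k = 0` case included: then the deformation sums are absent): for a non-null list `s`,
`|s| a_k(s) = Σ_{𝕊⁻(s)} a_k(s') − Σ_{𝕊⁺(s)} a_k(s') + 𝟙[k ≥ 1] (Σ_{𝔻⁻(s)} a_{k−1}(s') − Σ_{𝔻⁺(s)} a_{k−1}(s'))`.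
[cite: Chatterjee2019LargeN, Corollary 10.4; §12 (first-move decomposition of 𝒳ₖ(s))] -/
theorem len_mul_coeffA {s : LoopSeq d} (hs : s ≠ []) (hlen : 0 < s.len) (k : ℕ) :
    (s.len : ℝ) * coeffA s k =
      (∑ o : InvIdx s, coeffA (s.negSplitAt o) k) - (∑ o : SameIdx s, coeffA (s.posSplitAt o) k)
        + if 1 ≤ k then
            (∑ o : DeformIdx s, coeffA (s.negDeformAt o) (k - 1)) - ∑ o : DeformIdx s, coeffA (s.posDeformAt o) (k - 1)
          else 0 := by
  classical
  haveI : Fintype (TrajectoryWith s k) := @Fintype.ofFinite _ (finite_trajectoryWith s k)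
  letI : Fintype (Move s) := Fintype.ofEquiv _ (Move.equivSum (s := s)).symm
  haveI hfib : ∀ m : Move s, Fintype {Y : Trajectory m.result // m.dcount + Y.numDeform = k} := fun m => by
    haveI := finite_trajectoryWith m.result (k - m.dcount)
    exact @Fintype.ofFinite _ (Finite.of_injective
      (fun Y : {Y : Trajectory m.result // m.dcount + Y.numDeform = k} =>
        (⟨Y.1, by have := Y.2; omega⟩ : TrajectoryWith m.result (k - m.dcount)))
      (by
        rintro ⟨Y, hY⟩ ⟨Y', hY'⟩ h
        simp only [Subtype.mk.injEq] at h
        subst h; rfl))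
  -- first-move decomposition
  have h1 : coeffA s k = ∑ m : Move s, m.vweight *
      ∑ Y : {Y : Trajectory m.result // m.dcount + Y.numDeform = k}, Y.1.vweight := by
    rw [coeffA, tsum_fintype, ← (FirstMove.consEquiv hs k).symm.sum_comp, Fintype.sum_sigma]
    refine Finset.sum_congr rfl fun m _ => ?_
    rw [Finset.mul_sum]
    exact Finset.sum_congr rfl fun Y _ => rfl
  have hl : (s.len : ℝ) ≠ 0 := by exact_mod_cast hlen.ne'
  rw [h1, Finset.mul_sum]
  simp only [fibre_sum_eq]
  rw [← (Move.equivSum (s := s)).symm.sum_comp, Fintype.sum_sum_type, Fintype.sum_sum_type, Fintype.sum_sum_type]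
  by_cases hk : 1 ≤ k
  · simp only [Move.equivSum, Move.ofSum, Equiv.coe_fn_symm_mk, Move.dcount, Move.isDeform, if_true,
      show (1 : ℕ) ≤ k ↔ True from ⟨fun _ => trivial, fun _ => hk⟩, Move.result, Move.vweight, Bool.false_eq_true,
      if_false, zero_le, Nat.sub_zero, ← Finset.mul_sum]
    field_simp
    ring
  · have hk0 : k = 0 := by omega
    subst hk0
    simp only [Move.equivSum, Move.ofSum, Equiv.coe_fn_symm_mk, Move.dcount, Move.isDeform, if_true,
      Move.result, Move.vweight, Bool.false_eq_true, if_false, Nat.sub_zero, le_refl,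
      show ¬ ((1 : ℕ) ≤ 0) from Nat.not_succ_le_zero 0, mul_zero, Finset.sum_const_zero, zero_add, add_zero,
      ← Finset.mul_sum]
    field_simp
    ring

/-! ### Concatenated loop sequences `(s₁, s₂)`: operations act in one block -/

/-- Deleting null loops block by block (the second block has none). [cite: Chatterjee2019LargeN, §2.1 (minimal representation)] -/
theorem prune_append_right {s₂ : LoopSeq d} (h₂ : ∀ l ∈ s₂, l ≠ []) (A : LoopSeq d) :
    LoopSeq.prune (A ++ s₂) = LoopSeq.prune A ++ s₂ := by
  conv_rhs => rw [← LoopSeq.prune_eq_self h₂]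
  simp [LoopSeq.prune, List.filter_append]

/-- Deleting null loops block by block (the first block has none). [cite: Chatterjee2019LargeN, §2.1 (minimal representation)] -/
theorem prune_append_left {s₁ : LoopSeq d} (h₁ : ∀ l ∈ s₁, l ≠ []) (B : LoopSeq d) :
    LoopSeq.prune (s₁ ++ B) = s₁ ++ LoopSeq.prune B := by
  conv_rhs => rw [← LoopSeq.prune_eq_self h₁]
  simp [LoopSeq.prune, List.filter_append]

/-- An operation on a component of the first block: `(s₁, s₂)` with `lᵢ ↦ ws` is `((s₁ with lᵢ ↦ ws), s₂)`.
[cite: Chatterjee2019LargeN, §13 (proof of Lemma 13.3: «any component of Y is a loop sequence of the form (s, s')»)] -/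
theorem replaceAt_append_left {s₁ s₂ : LoopSeq d} (h₂ : ∀ l ∈ s₂, l ≠ []) {i : ℕ} (hi : i < s₁.length)
    (ws : List (Word d)) : LoopSeq.replaceAt (s₁ ++ s₂) i ws = LoopSeq.replaceAt s₁ i ws ++ s₂ := by
  rw [LoopSeq.replaceAt, LoopSeq.replaceAt, List.take_append_of_le_length hi.le,
    List.drop_append_of_le_length (by omega), ← List.append_assoc, prune_append_right h₂]

/-- An operation on a component of the second block: `(s₁, s₂)` with `l_{#s₁+i} ↦ ws` is `(s₁, (s₂ with lᵢ ↦ ws))`.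
[cite: Chatterjee2019LargeN, §13 (proof of Lemma 13.3)] -/
theorem replaceAt_append_right {s₁ s₂ : LoopSeq d} (h₁ : ∀ l ∈ s₁, l ≠ []) (i : ℕ) (ws : List (Word d)) :
    LoopSeq.replaceAt (s₁ ++ s₂) (s₁.length + i) ws = s₁ ++ LoopSeq.replaceAt s₂ i ws := by
  rw [LoopSeq.replaceAt, LoopSeq.replaceAt, List.take_append, List.drop_append,
    List.take_of_length_le (by omega : s₁.length ≤ s₁.length + i),
    List.drop_of_length_le (by omega : s₁.length ≤ s₁.length + i + 1),
    show s₁.length + i - s₁.length = i by omega, show s₁.length + i + 1 - s₁.length = i + 1 by omega, List.nil_append,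
    List.append_assoc, List.append_assoc, prune_append_left h₁, ← List.append_assoc]

/-- Componentwise sums over a concatenation split into the two blocks. [cite: Chatterjee2019LargeN, §13 (proof of Corollary 3.2)] -/
theorem sum_fin_get_append (G : ℕ → Word d → ℝ) :
    ∀ s₁ s₂ : LoopSeq d, ∑ i : Fin (s₁ ++ s₂).length, G i ((s₁ ++ s₂).get i)
      = ∑ i : Fin s₁.length, G i (s₁.get i) + ∑ i : Fin s₂.length, G (s₁.length + i) (s₂.get i)
  | [], s₂ => by
    show ∑ i : Fin s₂.length, G i (s₂.get i) = ∑ i : Fin 0, G i (([] : LoopSeq d).get i) + _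
    simp
  | l :: s₁, s₂ => by
    show ∑ i : Fin ((s₁ ++ s₂).length + 1), G i ((l :: (s₁ ++ s₂)).get i)
      = ∑ i : Fin (s₁.length + 1), G i ((l :: s₁).get i) + ∑ i : Fin s₂.length, G (s₁.length + 1 + i) (s₂.get i)
    rw [Fin.sum_univ_succ, Fin.sum_univ_succ, add_assoc]
    congr 1
    have ih := sum_fin_get_append (fun i w => G (i + 1) w) s₁ s₂
    have h : ∀ i : Fin s₂.length, G (s₁.length + ↑i + 1) (s₂.get i) = G (s₁.length + 1 + ↑i) (s₂.get i) :=
      fun i => by rw [Nat.add_right_comm]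
    simp only [h] at ih
    exact ih

/-- `ι(s₁, s₂) = ι(s₁) + ι(s₂)` (no null loops). [cite: Chatterjee2019LargeN, §9 (ι(s) = |s| − #s)] -/
theorem index_append {s₁ s₂ : LoopSeq d} (h₁ : ∀ l ∈ s₁, l ≠ []) (h₂ : ∀ l ∈ s₂, l ≠ []) :
    (s₁ ++ s₂).index = s₁.index + s₂.index := by
  have h1 := LoopSeq.size_le_len h₁
  have h2 := LoopSeq.size_le_len h₂
  simp only [LoopSeq.index, LoopSeq.len_append, LoopSeq.size_append]
  omega

/-! ### The operation sums of `𝕊^±(s₁, s₂)`, `𝔻^±(s₁, s₂)` split into the two blocks -/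

/-- **Splitting the operation sums of a concatenation** (`𝕊⁺`): an operation on `(s₁, s₂)` acts on a component of `s₁`
(leaving `s₂`) or on a component of `s₂` (leaving `s₁`). [cite: Chatterjee2019LargeN, §13 (proof of Lemma 13.3: «either s_{i+1} is a deformation or splitting of s_i and s'_{i+1} = s'_i, or …»)] -/
theorem sum_sameIdx_append {s₁ s₂ : LoopSeq d} (h₁ : ∀ l ∈ s₁, l ≠ []) (h₂ : ∀ l ∈ s₂, l ≠ []) (F : LoopSeq d → ℝ) :
    ∑ o : SameIdx (s₁ ++ s₂), F ((s₁ ++ s₂).posSplitAt o)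
      = ∑ o : SameIdx s₁, F (s₁.posSplitAt o ++ s₂) + ∑ o : SameIdx s₂, F (s₁ ++ s₂.posSplitAt o) := by
  have key := sum_fin_get_append (fun n w => ∑ xy ∈ univ.filter (fun xy : Fin w.length × Fin w.length =>
      xy.1 ≠ xy.2 ∧ w.get xy.2 = w.get xy.1),
      F ((s₁ ++ s₂).replaceAt n [Word.posSplit₁ w xy.1 xy.2, Word.posSplit₂ w xy.1 xy.2])) s₁ s₂
  rw [Fintype.sum_sigma, Fintype.sum_sigma, Fintype.sum_sigma]
  convert key using 1
  · refine Finset.sum_congr rfl fun i _ => ?_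
    symm
    apply Finset.sum_subtype
    intro xy
    simp
  · congr 1
    · refine Finset.sum_congr rfl fun i _ => ?_
      rw [Finset.sum_subtype (p := fun xy : Fin (s₁.get i).length × Fin (s₁.get i).length =>
          xy.1 ≠ xy.2 ∧ (s₁.get i).get xy.2 = (s₁.get i).get xy.1) (univ.filter fun xy =>
          xy.1 ≠ xy.2 ∧ (s₁.get i).get xy.2 = (s₁.get i).get xy.1) (by intro xy; simp)]
      refine Finset.sum_congr rfl fun xy _ => ?_
      rw [replaceAt_append_left h₂ i.isLt]
      rfl
    · refine Finset.sum_congr rfl fun i _ => ?_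
      rw [Finset.sum_subtype (p := fun xy : Fin (s₂.get i).length × Fin (s₂.get i).length =>
          xy.1 ≠ xy.2 ∧ (s₂.get i).get xy.2 = (s₂.get i).get xy.1) (univ.filter fun xy =>
          xy.1 ≠ xy.2 ∧ (s₂.get i).get xy.2 = (s₂.get i).get xy.1) (by intro xy; simp)]
      refine Finset.sum_congr rfl fun xy _ => ?_
      rw [replaceAt_append_right h₁]
      rfl

/-- Splitting the operation sums of a concatenation (`𝕊⁻`). [cite: Chatterjee2019LargeN, §13 (proof of Lemma 13.3)] -/
theorem sum_invIdx_append {s₁ s₂ : LoopSeq d} (h₁ : ∀ l ∈ s₁, l ≠ []) (h₂ : ∀ l ∈ s₂, l ≠ []) (F : LoopSeq d → ℝ) :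
    ∑ o : InvIdx (s₁ ++ s₂), F ((s₁ ++ s₂).negSplitAt o)
      = ∑ o : InvIdx s₁, F (s₁.negSplitAt o ++ s₂) + ∑ o : InvIdx s₂, F (s₁ ++ s₂.negSplitAt o) := by
  have key := sum_fin_get_append (fun n w => ∑ xy ∈ univ.filter (fun xy : Fin w.length × Fin w.length =>
      w.get xy.2 = DEdge.inv (w.get xy.1)),
      F ((s₁ ++ s₂).replaceAt n [Word.negSplit₁ w xy.1 xy.2, Word.negSplit₂ w xy.1 xy.2])) s₁ s₂
  rw [Fintype.sum_sigma, Fintype.sum_sigma, Fintype.sum_sigma]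
  convert key using 1
  · refine Finset.sum_congr rfl fun i _ => ?_
    symm
    apply Finset.sum_subtype
    intro xy
    simp
  · congr 1
    · refine Finset.sum_congr rfl fun i _ => ?_
      rw [Finset.sum_subtype (p := fun xy : Fin (s₁.get i).length × Fin (s₁.get i).length =>
          (s₁.get i).get xy.2 = DEdge.inv ((s₁.get i).get xy.1)) (univ.filter fun xy =>
          (s₁.get i).get xy.2 = DEdge.inv ((s₁.get i).get xy.1)) (by intro xy; simp)]
      refine Finset.sum_congr rfl fun xy _ => ?_
      rw [replaceAt_append_left h₂ i.isLt]
      rfl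
    · refine Finset.sum_congr rfl fun i _ => ?_
      rw [Finset.sum_subtype (p := fun xy : Fin (s₂.get i).length × Fin (s₂.get i).length =>
          (s₂.get i).get xy.2 = DEdge.inv ((s₂.get i).get xy.1)) (univ.filter fun xy =>
          (s₂.get i).get xy.2 = DEdge.inv ((s₂.get i).get xy.1)) (by intro xy; simp)]
      refine Finset.sum_congr rfl fun xy _ => ?_
      rw [replaceAt_append_right h₁]
      rfl

/-- Splitting the operation sums of a concatenation (`𝔻^±`). [cite: Chatterjee2019LargeN, §13 (proof of Lemma 13.3)] -/
theorem sum_deformIdx_append {s₁ s₂ : LoopSeq d} (h₁ : ∀ l ∈ s₁, l ≠ []) (h₂ : ∀ l ∈ s₂, l ≠ []) (F : LoopSeq d → ℝ)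
    (op : (w : Word d) → Fin w.length → ZdPlaquette d → Word d) :
    ∑ o : DeformIdx (s₁ ++ s₂), F ((s₁ ++ s₂).replaceAt o.1 [op ((s₁ ++ s₂).get o.1) o.2.1 o.2.2.1])
      = ∑ o : DeformIdx s₁, F (s₁.replaceAt o.1 [op (s₁.get o.1) o.2.1 o.2.2.1] ++ s₂)
        + ∑ o : DeformIdx s₂, F (s₁ ++ s₂.replaceAt o.1 [op (s₂.get o.1) o.2.1 o.2.2.1]) := by
  have key := sum_fin_get_append
    (fun n w => ∑ x : Fin w.length, ∑ p ∈ plaquettesAt (w.get x), F ((s₁ ++ s₂).replaceAt n [op w x p])) s₁ s₂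
  rw [Fintype.sum_sigma, Fintype.sum_sigma, Fintype.sum_sigma]
  convert key using 1
  · refine Finset.sum_congr rfl fun i _ => ?_
    rw [Fintype.sum_sigma]
    refine Finset.sum_congr rfl fun x _ => ?_
    exact Finset.sum_coe_sort (plaquettesAt (((s₁ ++ s₂).get i).get x))
      (fun p => F ((s₁ ++ s₂).replaceAt i [op ((s₁ ++ s₂).get i) x p]))
  · congr 1
    · refine Finset.sum_congr rfl fun i _ => ?_
      rw [Fintype.sum_sigma]
      refine Finset.sum_congr rfl fun x _ => ?_
      rw [← Finset.sum_coe_sort (plaquettesAt ((s₁.get i).get x))]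
      refine Finset.sum_congr rfl fun p _ => ?_
      rw [replaceAt_append_left h₂ i.isLt]
    · refine Finset.sum_congr rfl fun i _ => ?_
      rw [Fintype.sum_sigma]
      refine Finset.sum_congr rfl fun x _ => ?_
      rw [← Finset.sum_coe_sort (plaquettesAt ((s₂.get i).get x))]
      refine Finset.sum_congr rfl fun p _ => ?_
      rw [replaceAt_append_right h₁]

/-! ### The Cauchy-product identity `a_k(s₁, s₂) = Σ_{k₁+k₂=k} a_{k₁}(s₁) a_{k₂}(s₂)` -/

/-- A non-null list of non-null loops has positive length `|s| ≥ 1`. [cite: Chatterjee2019LargeN, §2.1 (|s|)] -/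
theorem len_pos_of_ne_nil {s : LoopSeq d} (hs : ∀ l ∈ s, l ≠ []) (hne : s ≠ []) : 0 < s.len := by
  have h1 : 1 ≤ LoopSeq.size s := by rw [LoopSeq.size]; exact List.length_pos_iff.mpr hne
  exact lt_of_lt_of_le (by omega) (LoopSeq.size_le_len hs)

/-- `Σ_{k₁+k₂=k} a_{k₁}(∅) b_{k₂} = b_k`. [cite: Chatterjee2019LargeN, Corollary 3.5 («a₀(∅) = 1 and a_k(∅) = 0 for all k ≥ 1»)] -/
theorem sum_antidiagonal_coeffA_nil_left (b : ℕ → ℝ) (k : ℕ) :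
    ∑ kl ∈ antidiagonal k, coeffA ([] : LoopSeq d) kl.1 * b kl.2 = b k := by
  rw [Finset.sum_eq_single (0, k)]
  · rw [coeffA_nil_zero, one_mul]
  · rintro ⟨i, j⟩ hij hne
    rw [Finset.HasAntidiagonal.mem_antidiagonal] at hij
    have hi : 1 ≤ i := by
      by_contra h
      apply hne
      simp only [Prod.mk.injEq]
      omega
    rw [coeffA_nil_of_pos hi, zero_mul]
  · intro h
    exact absurd (by simp) h

/-- `Σ_{k₁+k₂=k} b_{k₁} a_{k₂}(∅) = b_k`. [cite: Chatterjee2019LargeN, Corollary 3.5 («a₀(∅) = 1 and a_k(∅) = 0 for all k ≥ 1»)] -/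
theorem sum_antidiagonal_coeffA_nil_right (b : ℕ → ℝ) (k : ℕ) :
    ∑ kl ∈ antidiagonal k, b kl.1 * coeffA ([] : LoopSeq d) kl.2 = b k := by
  rw [Finset.sum_eq_single (k, 0)]
  · rw [coeffA_nil_zero, mul_one]
  · rintro ⟨i, j⟩ hij hne
    rw [Finset.HasAntidiagonal.mem_antidiagonal] at hij
    have hj : 1 ≤ j := by
      by_contra h
      apply hne
      simp only [Prod.mk.injEq]
      omega
    rw [coeffA_nil_of_pos hj, mul_zero]
  · intro h
    exact absurd (by simp) h

/-- **The strong-coupling coefficients of a concatenated loop sequence are the Cauchy product of those of the blocks**: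
`a_k(s₁, s₂) = Σ_{k₁+k₂=k} a_{k₁}(s₁) a_{k₂}(s₂)` for lists `s₁, s₂` of non-null loops — the `β`-expanded (coefficient)
form of §13's factorization `Σ_{X∈𝒳(l,l')} w_β(X) = Σ_{X∈𝒳(l)} w_β(X) · Σ_{X'∈𝒳(l')} w_β(X')` (Lemmas 13.2–13.3).  Proof by
the nested induction on `(k, ι)` of §§10–12 using the first-move recursion (`len_mul_coeffA`): a move of `(s₁, s₂)` acts in
one block (`sum_*_append`), its weight `∓1/|s|` is `|sᵢ|/|s|` times the block weight, and `|s₁| + |s₂| = |s|` — the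
`β`-free counterpart of the scheduler identity of Lemma 13.2.
[cite: Chatterjee2019LargeN, §13: Lemma 13.2, Lemma 13.3 and the proof of Corollary 3.2] -/
theorem coeffA_append {s₁ s₂ : LoopSeq d} (h₁ : ∀ l ∈ s₁, l ≠ []) (h₂ : ∀ l ∈ s₂, l ≠ []) (k : ℕ) :
    coeffA (s₁ ++ s₂) k = ∑ kl ∈ antidiagonal k, coeffA s₁ kl.1 * coeffA s₂ kl.2 := by
  -- nested induction: outer on `k`, inner on `ι(s₁, s₂)`
  induction k using Nat.strong_induction_on generalizing s₁ s₂ with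
  | _ k ihk =>
  suffices main : ∀ (n : ℕ) (s₁ s₂ : LoopSeq d), (∀ l ∈ s₁, l ≠ []) → (∀ l ∈ s₂, l ≠ []) → (s₁ ++ s₂).index = n →
      coeffA (s₁ ++ s₂) k = ∑ kl ∈ antidiagonal k, coeffA s₁ kl.1 * coeffA s₂ kl.2 from main _ s₁ s₂ h₁ h₂ rfl
  intro n
  induction n using Nat.strong_induction_on with
  | _ n ihn =>
  intro s₁ s₂ h₁ h₂ hsn
  -- null blocks
  by_cases hs₁ : s₁ = []
  · subst hs₁
    rw [List.nil_append, sum_antidiagonal_coeffA_nil_left]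
  by_cases hs₂ : s₂ = []
  · subst hs₂
    rw [List.append_nil, sum_antidiagonal_coeffA_nil_right]
  -- both blocks non-null
  have hs : s₁ ++ s₂ ≠ [] := by simp [hs₁]
  have hs' : ∀ l ∈ s₁ ++ s₂, l ≠ [] := fun l hl => by
    rcases List.mem_append.1 hl with hl | hl
    · exact h₁ l hl
    · exact h₂ l hl
  have hl₁ := len_pos_of_ne_nil h₁ hs₁
  have hl₂ := len_pos_of_ne_nil h₂ hs₂
  have hl : 0 < (s₁ ++ s₂).len := by rw [LoopSeq.len_append]; omega
  have hlen : ((s₁ ++ s₂).len : ℝ) = s₁.len + s₂.len := by rw [LoopSeq.len_append]; push_cast; ring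
  have hlr : ((s₁ ++ s₂).len : ℝ) ≠ 0 := by exact_mod_cast hl.ne'
  have hidx := index_append h₁ h₂
  -- the induction hypotheses on the results of one move in one block
  have ihSplit₁ : ∀ t : LoopSeq d, (∀ l ∈ t, l ≠ []) → t.index < s₁.index →
      coeffA (t ++ s₂) k = ∑ kl ∈ antidiagonal k, coeffA t kl.1 * coeffA s₂ kl.2 := fun t ht hti =>
    ihn _ (by rw [← hsn, hidx, index_append ht h₂]; omega) t s₂ ht h₂ rfl
  have ihSplit₂ : ∀ t : LoopSeq d, (∀ l ∈ t, l ≠ []) → t.index < s₂.index →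
      coeffA (s₁ ++ t) k = ∑ kl ∈ antidiagonal k, coeffA s₁ kl.1 * coeffA t kl.2 := fun t ht hti =>
    ihn _ (by rw [← hsn, hidx, index_append h₁ ht]; omega) s₁ t h₁ ht rfl
  have ihDef₁ : ∀ j < k, ∀ t : LoopSeq d, (∀ l ∈ t, l ≠ []) →
      coeffA (t ++ s₂) j = ∑ kl ∈ antidiagonal j, coeffA t kl.1 * coeffA s₂ kl.2 := fun j hj t ht => ihk j hj ht h₂
  have ihDef₂ : ∀ j < k, ∀ t : LoopSeq d, (∀ l ∈ t, l ≠ []) →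
      coeffA (s₁ ++ t) j = ∑ kl ∈ antidiagonal j, coeffA s₁ kl.1 * coeffA t kl.2 := fun j hj t ht => ihk j hj h₁ ht
  -- the first-move recursions for `s`, `s₁`, `s₂`
  have hrec := len_mul_coeffA hs hl k
  have hrec₁ := fun j => len_mul_coeffA hs₁ hl₁ j
  have hrec₂ := fun j => len_mul_coeffA hs₂ hl₂ j
  -- the splitting sums of `s`, block by block, with the inner induction hypothesis
  have hSn : ∑ o : InvIdx (s₁ ++ s₂), coeffA ((s₁ ++ s₂).negSplitAt o) k
      = ∑ kl ∈ antidiagonal k, ((∑ o : InvIdx s₁, coeffA (s₁.negSplitAt o) kl.1) * coeffA s₂ kl.2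
          + coeffA s₁ kl.1 * ∑ o : InvIdx s₂, coeffA (s₂.negSplitAt o) kl.2) := by
    rw [sum_invIdx_append h₁ h₂ (fun t => coeffA t k), Finset.sum_add_distrib]
    congr 1
    · simp only [Finset.sum_mul]
      rw [Finset.sum_comm]
      exact Finset.sum_congr rfl fun o _ => ihSplit₁ _ (LoopSeq.ne_nil_of_mem_replaceAt _ _ _) (LoopSeq.index_negSplitAt_lt h₁ o)
    · simp only [Finset.mul_sum]
      rw [Finset.sum_comm]
      exact Finset.sum_congr rfl fun o _ => ihSplit₂ _ (LoopSeq.ne_nil_of_mem_replaceAt _ _ _) (LoopSeq.index_negSplitAt_lt h₂ o)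
  have hSp : ∑ o : SameIdx (s₁ ++ s₂), coeffA ((s₁ ++ s₂).posSplitAt o) k
      = ∑ kl ∈ antidiagonal k, ((∑ o : SameIdx s₁, coeffA (s₁.posSplitAt o) kl.1) * coeffA s₂ kl.2
          + coeffA s₁ kl.1 * ∑ o : SameIdx s₂, coeffA (s₂.posSplitAt o) kl.2) := by
    rw [sum_sameIdx_append h₁ h₂ (fun t => coeffA t k), Finset.sum_add_distrib]
    congr 1
    · simp only [Finset.sum_mul]
      rw [Finset.sum_comm]
      exact Finset.sum_congr rfl fun o _ => ihSplit₁ _ (LoopSeq.ne_nil_of_mem_replaceAt _ _ _) (LoopSeq.index_posSplitAt_lt h₁ o)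
    · simp only [Finset.mul_sum]
      rw [Finset.sum_comm]
      exact Finset.sum_congr rfl fun o _ => ihSplit₂ _ (LoopSeq.ne_nil_of_mem_replaceAt _ _ _) (LoopSeq.index_posSplitAt_lt h₂ o)
  -- case `k = 0`: no deformation terms
  rcases Nat.eq_zero_or_pos k with hk | hk
  · subst hk
    have h1 := hrec₁ 0
    have h2 := hrec₂ 0
    simp only [show ¬ (1 ≤ 0) from Nat.not_succ_le_zero 0, if_false, add_zero, Finset.Nat.antidiagonal_zero,
      Finset.sum_singleton] at hrec h1 h2 hSn hSp ⊢
    rw [hSn, hSp] at hrec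
    refine mul_left_cancel₀ hlr ?_
    rw [hrec, hlen]
    linear_combination (-(coeffA s₂ 0)) * h1 + (-(coeffA s₁ 0)) * h2
  -- case `k = k' + 1`: deformation terms, with the outer induction hypothesis at `k'`
  obtain ⟨k', rfl⟩ : ∃ k', k = k' + 1 := ⟨k - 1, by omega⟩
  have hDn : ∑ o : DeformIdx (s₁ ++ s₂), coeffA ((s₁ ++ s₂).negDeformAt o) k'
      = ∑ kl ∈ antidiagonal k', ((∑ o : DeformIdx s₁, coeffA (s₁.negDeformAt o) kl.1) * coeffA s₂ kl.2
          + coeffA s₁ kl.1 * ∑ o : DeformIdx s₂, coeffA (s₂.negDeformAt o) kl.2) := by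
    refine (sum_deformIdx_append h₁ h₂ (fun t => coeffA t k') Word.negDeform).trans ?_
    rw [Finset.sum_add_distrib]
    congr 1
    · simp only [Finset.sum_mul]
      rw [Finset.sum_comm]
      exact Finset.sum_congr rfl fun o _ => ihDef₁ k' (by omega) _ (LoopSeq.ne_nil_of_mem_replaceAt _ _ _)
    · simp only [Finset.mul_sum]
      rw [Finset.sum_comm]
      exact Finset.sum_congr rfl fun o _ => ihDef₂ k' (by omega) _ (LoopSeq.ne_nil_of_mem_replaceAt _ _ _)
  have hDp : ∑ o : DeformIdx (s₁ ++ s₂), coeffA ((s₁ ++ s₂).posDeformAt o) k'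
      = ∑ kl ∈ antidiagonal k', ((∑ o : DeformIdx s₁, coeffA (s₁.posDeformAt o) kl.1) * coeffA s₂ kl.2
          + coeffA s₁ kl.1 * ∑ o : DeformIdx s₂, coeffA (s₂.posDeformAt o) kl.2) := by
    refine (sum_deformIdx_append h₁ h₂ (fun t => coeffA t k') Word.posDeform).trans ?_
    rw [Finset.sum_add_distrib]
    congr 1
    · simp only [Finset.sum_mul]
      rw [Finset.sum_comm]
      exact Finset.sum_congr rfl fun o _ => ihDef₁ k' (by omega) _ (LoopSeq.ne_nil_of_mem_replaceAt _ _ _)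
    · simp only [Finset.mul_sum]
      rw [Finset.sum_comm]
      exact Finset.sum_congr rfl fun o _ => ihDef₂ k' (by omega) _ (LoopSeq.ne_nil_of_mem_replaceAt _ _ _)
  simp only [show 1 ≤ k' + 1 from Nat.succ_le_succ (Nat.zero_le _), if_true, Nat.add_sub_cancel] at hrec
  rw [hSn, hSp, hDn, hDp] at hrec
  -- the target, multiplied by `|s| = |s₁| + |s₂|`, through the block recursions
  have hT : ((s₁.len : ℝ) + s₂.len) * ∑ kl ∈ antidiagonal (k' + 1), coeffA s₁ kl.1 * coeffA s₂ kl.2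
      = ∑ kl ∈ antidiagonal (k' + 1),
          (((∑ o : InvIdx s₁, coeffA (s₁.negSplitAt o) kl.1) - ∑ o : SameIdx s₁, coeffA (s₁.posSplitAt o) kl.1)
            * coeffA s₂ kl.2
          + coeffA s₁ kl.1 *
            ((∑ o : InvIdx s₂, coeffA (s₂.negSplitAt o) kl.2) - ∑ o : SameIdx s₂, coeffA (s₂.posSplitAt o) kl.2))
        + (∑ kl ∈ antidiagonal (k' + 1),
            (if 1 ≤ kl.1 then (∑ o : DeformIdx s₁, coeffA (s₁.negDeformAt o) (kl.1 - 1))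
              - ∑ o : DeformIdx s₁, coeffA (s₁.posDeformAt o) (kl.1 - 1) else 0) * coeffA s₂ kl.2
          + ∑ kl ∈ antidiagonal (k' + 1), coeffA s₁ kl.1 *
            (if 1 ≤ kl.2 then (∑ o : DeformIdx s₂, coeffA (s₂.negDeformAt o) (kl.2 - 1))
              - ∑ o : DeformIdx s₂, coeffA (s₂.posDeformAt o) (kl.2 - 1) else 0)) := by
    rw [Finset.mul_sum, ← Finset.sum_add_distrib, ← Finset.sum_add_distrib]
    refine Finset.sum_congr rfl fun kl _ => ?_
    have e1 := hrec₁ kl.1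
    have e2 := hrec₂ kl.2
    linear_combination coeffA s₂ kl.2 * e1 + coeffA s₁ kl.1 * e2
  -- re-index the deformation sums: `k₁ ≥ 1` over `k₁ + k₂ = k'+1` is `k₁' + k₂ = k'`
  have hE1 : ∑ kl ∈ antidiagonal (k' + 1),
      (if 1 ≤ kl.1 then (∑ o : DeformIdx s₁, coeffA (s₁.negDeformAt o) (kl.1 - 1))
        - ∑ o : DeformIdx s₁, coeffA (s₁.posDeformAt o) (kl.1 - 1) else 0) * coeffA s₂ kl.2
      = ∑ kl ∈ antidiagonal k', ((∑ o : DeformIdx s₁, coeffA (s₁.negDeformAt o) kl.1)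
        - ∑ o : DeformIdx s₁, coeffA (s₁.posDeformAt o) kl.1) * coeffA s₂ kl.2 := by
    rw [Finset.Nat.sum_antidiagonal_succ]
    simp
  have hE2 : ∑ kl ∈ antidiagonal (k' + 1), coeffA s₁ kl.1 *
      (if 1 ≤ kl.2 then (∑ o : DeformIdx s₂, coeffA (s₂.negDeformAt o) (kl.2 - 1))
        - ∑ o : DeformIdx s₂, coeffA (s₂.posDeformAt o) (kl.2 - 1) else 0)
      = ∑ kl ∈ antidiagonal k', coeffA s₁ kl.1 * ((∑ o : DeformIdx s₂, coeffA (s₂.negDeformAt o) kl.2)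
        - ∑ o : DeformIdx s₂, coeffA (s₂.posDeformAt o) kl.2) := by
    rw [Finset.Nat.sum_antidiagonal_succ']
    simp
  rw [hE1, hE2] at hT
  refine mul_left_cancel₀ hlr ?_
  rw [hrec, hlen, hT]
  simp only [Finset.sum_add_distrib, Finset.sum_sub_distrib, sub_mul, mul_sub]
  ring

/-! ### The power series `ψ_β(s) = Σ_k a_k(s) β^k` is multiplicative; Corollary 3.2 from Theorem 3.1 -/

/-- **Multiplicativity of the strong-coupling series**: `Σ_k a_k(s₁, s₂) β^k = (Σ_k a_k(s₁) β^k)(Σ_k a_k(s₂) β^k)` whenever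
both series converge absolutely (Cauchy product of `coeffA_append`). [cite: Chatterjee2019LargeN, §13 (proof of Corollary 3.2: «lim ⟨W_{l₁}⋯W_{lₙ}⟩/Nⁿ = Π lim ⟨W_{lᵢ}⟩/N»), Corollary 3.5] -/
theorem tsum_coeffA_mul_pow_append {β : ℝ} {s₁ s₂ : LoopSeq d} (h₁ : IsLoopSeq s₁) (h₂ : IsLoopSeq s₂)
    (hs₁ : Summable fun k : ℕ => |coeffA s₁ k * β ^ k|) (hs₂ : Summable fun k : ℕ => |coeffA s₂ k * β ^ k|) :
    ∑' k : ℕ, coeffA (s₁ ++ s₂) k * β ^ k = (∑' k : ℕ, coeffA s₁ k * β ^ k) * ∑' k : ℕ, coeffA s₂ k * β ^ k := by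
  have hn₁ : Summable fun k : ℕ => ‖coeffA s₁ k * β ^ k‖ := by simpa only [Real.norm_eq_abs] using hs₁
  have hn₂ : Summable fun k : ℕ => ‖coeffA s₂ k * β ^ k‖ := by simpa only [Real.norm_eq_abs] using hs₂
  rw [tsum_mul_tsum_eq_tsum_sum_antidiagonal_of_summable_norm hn₁ hn₂]
  refine tsum_congr fun n => ?_
  rw [coeffA_append (fun l hl => (h₁ l hl).2) (fun l hl => (h₂ l hl).2), Finset.sum_mul]
  refine Finset.sum_congr rfl fun kl hkl => ?_
  rw [Finset.HasAntidiagonal.mem_antidiagonal] at hkl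
  rw [← hkl, pow_add]
  ring

/-- `ψ_β(∅) = 1`. [cite: Chatterjee2019LargeN, Corollary 3.5 («a₀(∅) = 1 and a_k(∅) = 0 for all k ≥ 1»)] -/
theorem tsum_coeffA_mul_pow_nil (β : ℝ) : ∑' k : ℕ, coeffA ([] : LoopSeq d) k * β ^ k = 1 := by
  rw [tsum_eq_single 0 fun k hk => by rw [coeffA_nil_of_pos (Nat.one_le_iff_ne_zero.2 hk), zero_mul]]
  rw [coeffA_nil_zero, pow_zero, mul_one]

/-- **The strong-coupling series of a loop sequence is the product of the series of its loops**:
`Σ_k a_k(l₁, …, lₙ) β^k = Πᵢ Σ_k a_k(lᵢ) β^k` (absolute convergence assumed for all genuine loop sequences at this `β`).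
[cite: Chatterjee2019LargeN, §13 (proof of Corollary 3.2), Corollary 3.5] -/
theorem tsum_coeffA_mul_pow_eq_prod {β : ℝ}
    (hβ : ∀ s : LoopSeq d, IsLoopSeq s → Summable fun k : ℕ => |coeffA s k * β ^ k|) :
    ∀ s : LoopSeq d, IsLoopSeq s →
      ∑' k : ℕ, coeffA s k * β ^ k = ∏ i : Fin s.length, ∑' k : ℕ, coeffA [s.get i] k * β ^ k
  | [], _ => by rw [tsum_coeffA_mul_pow_nil]; rfl
  | l :: rest, hs => by
    have hl : IsLoopSeq [l] := fun l' hl' => by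
      rw [List.mem_singleton] at hl'
      subst hl'
      exact hs _ (by simp)
    have hrest : IsLoopSeq rest := fun u hu => hs u (List.mem_cons_of_mem _ hu)
    rw [show l :: rest = [l] ++ rest from rfl, tsum_coeffA_mul_pow_append hl hrest (hβ _ hl) (hβ _ hrest),
      tsum_coeffA_mul_pow_eq_prod hβ rest hrest]
    show _ = ∏ i : Fin (rest.length + 1), ∑' k : ℕ, coeffA [(l :: rest).get i] k * β ^ k
    rw [Fin.prod_univ_succ]
    rfl

end Factorization

open Factorization in
/-- ★ **Chatterjee 2019, Corollary 3.2 (factorization of Wilson loops) from Theorem 3.1, PROVED.** «Let all notation be as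
in Theorem 3.1, and suppose that `|β| ≤ β₀(d)`. Then for any non-null loops `l₁, …, lₙ`,
`lim ⟨W_{l₁} W_{l₂} ⋯ W_{lₙ}⟩/Nⁿ = Π lim ⟨W_{lᵢ}⟩/N`.»  Rendering = the tree's named fact `WilsonLoopFactorization`
(sibling `StrongCoupling`), here with `β₀ = min(β₀(Thm 3.1), 1/(2K⁵))`.  Proof: by Theorem 3.1 and Corollary 3.5
(`hasSum_coeffA_mul_pow`) every limit is the power series `ψ_β(s) = Σ_k a_k(s) β^k`, absolutely convergent for
`|β| ≤ 1/(2K⁵)` (`coeffA_mul_pow_summable_abs`, Lemma 10.1), and `ψ_β` is multiplicative over the loops of `s`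
(`tsum_coeffA_mul_pow_eq_prod`, from the coefficient identity `coeffA_append` — the `β`-expanded form of the printed §13
argument: Lemma 13.3's interleaving bijection `𝒳(l, l') ≅ {(X, X', α)}` and Lemma 13.2's identity for the weights).
[cite: Chatterjee2019LargeN, Corollary 3.2 and §13 (its proof); Theorem 3.1; Corollary 3.5] -/
theorem wilsonLoopFactorization_of_gaugeStringDuality (hG : GaugeStringDuality d) : WilsonLoopFactorization d := by
  intro hd
  obtain ⟨β₀, hβ₀, H⟩ := hG hd
  obtain ⟨β₁, hβ₁, H1⟩ := coeffA_mul_pow_summable_abs (d := d)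
  refine ⟨min β₀ β₁, lt_min hβ₀ hβ₁, fun Λ hΛ β hβ s hs _ => ?_⟩
  have hb0 : |β| ≤ β₀ := hβ.trans (min_le_left _ _)
  have hb1 : |β| ≤ β₁ := hβ.trans (min_le_right _ _)
  -- every limit is the power series `ψ_β`
  have hlim : ∀ t : LoopSeq d, IsLoopSeq t →
      Tendsto (fun N : ℕ => phi N β (Λ N) t) atTop (𝓝 (∑' k : ℕ, coeffA t k * β ^ k)) := by
    intro t ht
    obtain ⟨hsum, hl⟩ := H Λ hΛ β hb0 t ht
    rwa [← (hasSum_coeffA_mul_pow hsum).tsum_eq] at hl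
  have hgi : ∀ i : Fin s.length, IsLoopSeq [s.get i] := fun i l hl => by
    rw [List.mem_singleton] at hl
    subst hl
    exact hs _ (List.get_mem s i)
  refine ⟨fun i => ∑' k : ℕ, coeffA [s.get i] k * β ^ k, fun i => hlim _ (hgi i), ?_⟩
  rw [← tsum_coeffA_mul_pow_eq_prod (fun t ht => H1 β hb1 t ht) s hs]
  exact hlim s hs

/-! ### Corollary 3.2, «in particular»: `W_l/N` converges in probability to `lim ⟨W_l⟩/N` -/

section Concentration

open MeasureTheory

/-- The entries of the word holonomy `Q_{e₁} ⋯ Q_{eₙ}` are measurable functions of the configuration (finite sums of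
products of entries of the `Q_e^{±1}`). [cite: Chatterjee2019LargeN, §3 (W_l = tr(Q_{e₁} Q_{e₂} ⋯ Q_{eₙ}) as a random variable)] -/
theorem measurable_wordHolonomy_apply (N : ℕ) : ∀ (l : Word d) (a b : Fin N),
    Measurable fun U : ZdGaugeConfig d (SO N) => ((wordHolonomy U l : SO N) : Matrix (Fin N) (Fin N) ℝ) a b
  | [], a, b => by
    simp only [wordHolonomy, List.map_nil, List.prod_nil]
    exact measurable_const
  | x :: l, a, b => by
    have hstep : ∀ a c : Fin N, Measurable fun U : ZdGaugeConfig d (SO N) =>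
        (((if x.2 then U x.1 else (U x.1)⁻¹ : SO N)) : Matrix (Fin N) (Fin N) ℝ) a c := by
      intro a c
      cases hx : x.2
      · simp only [Bool.false_eq_true, if_false]
        exact ((continuous_subtype_val.comp continuous_inv).matrix_elem a c).measurable.comp (measurable_pi_apply x.1)
      · simp only [if_true]
        exact (continuous_subtype_val.matrix_elem a c).measurable.comp (measurable_pi_apply x.1)
    have h : ∀ U : ZdGaugeConfig d (SO N), ((wordHolonomy U (x :: l) : SO N) : Matrix (Fin N) (Fin N) ℝ) a b
        = ∑ c, (((if x.2 then U x.1 else (U x.1)⁻¹ : SO N)) : Matrix (Fin N) (Fin N) ℝ) a c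
            * ((wordHolonomy U l : SO N) : Matrix (Fin N) (Fin N) ℝ) c b := fun U => by
      rw [show (wordHolonomy U (x :: l) : SO N) = (if x.2 then U x.1 else (U x.1)⁻¹) * wordHolonomy U l by
        simp [wordHolonomy], Submonoid.coe_mul, Matrix.mul_apply]
    simp only [h]
    exact Finset.measurable_sum _ fun c _ => (hstep a c).mul (measurable_wordHolonomy_apply N l c b)

/-- `W_l` is a measurable function of the configuration. [cite: Chatterjee2019LargeN, §3 (W_l as a random variable; Corollary 3.2 «the random variable W_l/N»)] -/
theorem measurable_wilsonLoopVar (N : ℕ) (l : Word d) : Measurable (wilsonLoopVar (d := d) N l) := by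
  have h : wilsonLoopVar (d := d) N l = fun U => ∑ i, ((wordHolonomy U l : SO N) : Matrix (Fin N) (Fin N) ℝ) i i := by
    funext U
    rw [wilsonLoopVar, Matrix.trace]
    rfl
  rw [h]
  exact Finset.measurable_sum _ fun i _ => measurable_wordHolonomy_apply N l i i

/-- `μ_{Λ,N,β}` is a probability measure. [cite: Chatterjee2019LargeN, §3 ¶1 (μ_{Λ,N,β} is a probability measure)] -/
theorem isProbabilityMeasure_soMeasure (N : ℕ) (β : ℝ) (Λ : Finset (Literature.Probability.LatticeModels.Site d)) :
    IsProbabilityMeasure (soMeasure (d := d) N β Λ) := by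
  unfold soMeasure
  exact isProbabilityMeasure_zdWilsonMeasure (soRep N) (isSpecialOrthogonalModel_soRep N).1 (N * β) Λ

/-- `W_l` is integrable (`|W_l| ≤ N`, probability measure). [cite: Chatterjee2019LargeN, §3 (⟨W_l⟩ well defined), §9 (|W_l| ≤ N)] -/
theorem integrable_wilsonLoopVar (N : ℕ) (β : ℝ) (Λ : Finset (Literature.Probability.LatticeModels.Site d)) (l : Word d) :
    Integrable (wilsonLoopVar N l) (soMeasure N β Λ) := by
  haveI := isProbabilityMeasure_soMeasure (d := d) N β Λ
  refine Integrable.of_bound (μ := soMeasure N β Λ) (measurable_wilsonLoopVar N l).aestronglyMeasurable (N : ℝ)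
    (Filter.Eventually.of_forall fun U => ?_)
  rw [Real.norm_eq_abs]
  exact abs_wilsonLoopVar_le N l U

/-- `W_l²` is integrable. [cite: Chatterjee2019LargeN, Corollary 3.2 («⟨(W_l/N)²⟩»)] -/
theorem integrable_wilsonLoopVar_mul_self (N : ℕ) (β : ℝ) (Λ : Finset (Literature.Probability.LatticeModels.Site d))
    (l : Word d) : Integrable (fun U => wilsonLoopVar N l U * wilsonLoopVar N l U) (soMeasure N β Λ) := by
  haveI := isProbabilityMeasure_soMeasure (d := d) N β Λ
  refine Integrable.of_bound (μ := soMeasure N β Λ)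
    ((measurable_wilsonLoopVar N l).mul (measurable_wilsonLoopVar N l)).aestronglyMeasurable ((N : ℝ) * N)
    (Filter.Eventually.of_forall fun U => ?_)
  rw [Real.norm_eq_abs, abs_mul]
  exact mul_le_mul (abs_wilsonLoopVar_le N l U) (abs_wilsonLoopVar_le N l U) (abs_nonneg _) (Nat.cast_nonneg _)

/-- **The second moment about the limit**: `⟨(W_l/N − L)²⟩ = φ((l, l)) − 2L φ((l)) + L²`.
[cite: Chatterjee2019LargeN, Corollary 3.2 («⟨(W_l/N)²⟩ has the same limit as ⟨W_l/N⟩²»)] -/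
theorem integral_sq_sub_eq (N : ℕ) (β : ℝ) (Λ : Finset (Literature.Probability.LatticeModels.Site d)) (l : Word d) (L : ℝ) :
    ∫ U, (wilsonLoopVar N l U / N - L) ^ 2 ∂(soMeasure N β Λ)
      = phi N β Λ [l, l] - 2 * L * phi N β Λ [l] + L ^ 2 := by
  haveI := isProbabilityMeasure_soMeasure (d := d) N β Λ
  have h1 := integrable_wilsonLoopVar (d := d) N β Λ l
  have h2 := integrable_wilsonLoopVar_mul_self (d := d) N β Λ l
  have hexp : (fun U => (wilsonLoopVar N l U / N - L) ^ 2)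
      = fun U => ((1 / (N : ℝ) ^ 2) * (wilsonLoopVar N l U * wilsonLoopVar N l U)
          - (2 * L / N) * wilsonLoopVar N l U) + L ^ 2 := by
    funext U; ring
  have hphi2 : phi N β Λ [l, l] = (∫ U, wilsonLoopVar N l U * wilsonLoopVar N l U ∂(soMeasure N β Λ)) / (N : ℝ) ^ 2 := by
    simp [phi, soExpect, wilsonProd]
  have hphi1 : phi N β Λ [l] = (∫ U, wilsonLoopVar N l U ∂(soMeasure N β Λ)) / (N : ℝ) := by
    simp [phi, soExpect, wilsonProd]
  rw [hexp, integral_add (f := fun U => 1 / (N : ℝ) ^ 2 * (wilsonLoopVar N l U * wilsonLoopVar N l U)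
      - 2 * L / N * wilsonLoopVar N l U) (g := fun _ => L ^ 2) ((h2.const_mul _).sub (h1.const_mul _))
      (integrable_const _),
    integral_sub (f := fun U => 1 / (N : ℝ) ^ 2 * (wilsonLoopVar N l U * wilsonLoopVar N l U))
      (g := fun U => 2 * L / N * wilsonLoopVar N l U) (h2.const_mul _) (h1.const_mul _),
    integral_const_mul, integral_const_mul, integral_const, hphi2, hphi1]
  simp only [smul_eq_mul, probReal_univ, one_mul]
  ring

/-- ★ **Corollary 3.2, «in particular» (concentration of `W_l/N`), PROVED from Theorem 3.1**: «for any loop `l`,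
`⟨(W_l/N)²⟩` has the same limit as `⟨W_l/N⟩²`, … implying that the random variable `W_l/N` converges in probability to the
(deterministic) limit of `⟨W_l⟩/N` given in Theorem 3.1.»  Rendering: for `d ≥ 2`, `|β| ≤ β₀` (that of
`wilsonLoopFactorization_of_gaugeStringDuality`), every exhaustion and every genuine non-null loop `l`, with
`L = lim φ_{Λ_N,N,β}((l))`: for every `ε > 0`, `μ_{Λ_N,N,β}{|W_l/N − L| ≥ ε} → 0` as `N → ∞` (Chebyshev with
`⟨(W_l/N − L)²⟩ = φ((l,l)) − 2Lφ((l)) + L² → L·L − 2L² + L² = 0`, factorization for `s = (l, l)`).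
[cite: Chatterjee2019LargeN, Corollary 3.2 (last sentence)] -/
theorem wilsonLoopVar_tendsto_in_measure (hG : GaugeStringDuality d) : 2 ≤ d → ∃ β₀ : ℝ, 0 < β₀ ∧
    ∀ Λ : ℕ → Finset (Literature.Probability.LatticeModels.Site d), IsExhaustion Λ → ∀ β : ℝ, |β| ≤ β₀ →
      ∀ l : Word d, IsLoop l → l ≠ [] →
        ∃ L : ℝ, Tendsto (fun N : ℕ => phi N β (Λ N) [l]) atTop (𝓝 L) ∧
          ∀ ε : ℝ, 0 < ε → Tendsto (fun N : ℕ =>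
            (soMeasure N β (Λ N)).real {U | ε ≤ |wilsonLoopVar N l U / N - L|}) atTop (𝓝 0) := by
  intro hd
  obtain ⟨β₀, hβ₀, H⟩ := wilsonLoopFactorization_of_gaugeStringDuality hG hd
  refine ⟨β₀, hβ₀, fun Λ hΛ β hβ l hl hne => ?_⟩
  have hs : IsLoopSeq [l, l] := by
    intro l' hl'
    simp only [List.mem_cons, List.not_mem_nil, or_false] at hl'
    rcases hl' with rfl | rfl <;> exact ⟨hl, hne⟩
  obtain ⟨Lf, hLi, hLprod⟩ := H Λ hΛ β hβ [l, l] hs (by simp)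
  have hL := hLi ⟨0, by simp⟩
  have hL1 : Lf ⟨1, by simp⟩ = Lf ⟨0, by simp⟩ := tendsto_nhds_unique (hLi ⟨1, by simp⟩) hL
  have hprod : Tendsto (fun N : ℕ => phi N β (Λ N) [l, l]) atTop (𝓝 (Lf ⟨0, by simp⟩ * Lf ⟨0, by simp⟩)) := by
    have h2 : ∏ i, Lf i = Lf ⟨0, by simp⟩ * Lf ⟨0, by simp⟩ := by
      rw [show (∏ i, Lf i) = Lf ⟨0, by simp⟩ * Lf ⟨1, by simp⟩ from Fin.prod_univ_two Lf, hL1]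
    rwa [h2] at hLprod
  refine ⟨Lf ⟨0, by simp⟩, hL, fun ε hε => ?_⟩
  set L := Lf ⟨0, by simp⟩ with hLdef
  -- the second moment tends to `0`
  have hE0 : Tendsto (fun N : ℕ => phi N β (Λ N) [l, l] - 2 * L * phi N β (Λ N) [l] + L ^ 2) atTop (𝓝 0) := by
    have h := (hprod.sub (hL.const_mul (2 * L))).add (tendsto_const_nhds (x := L ^ 2))
    have h0 : L * L - 2 * L * L + L ^ 2 = 0 := by ring
    rwa [h0] at h
  -- Chebyshev
  have hbound : ∀ N : ℕ, (soMeasure N β (Λ N)).real {U | ε ≤ |wilsonLoopVar N l U / N - L|}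
      ≤ (phi N β (Λ N) [l, l] - 2 * L * phi N β (Λ N) [l] + L ^ 2) / ε ^ 2 := by
    intro N
    haveI := isProbabilityMeasure_soMeasure (d := d) N β (Λ N)
    have hset : {U : ZdGaugeConfig d (SO N) | ε ≤ |wilsonLoopVar N l U / N - L|}
        = {U | ε ^ 2 ≤ (wilsonLoopVar N l U / N - L) ^ 2} := by
      ext U
      simp only [Set.mem_setOf_eq]
      rw [sq_le_sq, abs_of_pos hε]
    have hint : Integrable (fun U => (wilsonLoopVar N l U / N - L) ^ 2) (soMeasure N β (Λ N)) := by
      have h1 := integrable_wilsonLoopVar (d := d) N β (Λ N) l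
      have h2 := integrable_wilsonLoopVar_mul_self (d := d) N β (Λ N) l
      have hexp : (fun U => (wilsonLoopVar N l U / N - L) ^ 2)
          = fun U => ((1 / (N : ℝ) ^ 2) * (wilsonLoopVar N l U * wilsonLoopVar N l U)
              - (2 * L / N) * wilsonLoopVar N l U) + L ^ 2 := by
        funext U; ring
      rw [hexp]
      exact ((h2.const_mul _).sub (h1.const_mul _)).add (integrable_const _)
    have hM := mul_meas_ge_le_integral_of_nonneg (μ := soMeasure N β (Λ N))
      (Filter.Eventually.of_forall fun U => sq_nonneg (wilsonLoopVar N l U / N - L)) hint (ε ^ 2)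
    rw [integral_sq_sub_eq, ← hset] at hM
    rw [le_div_iff₀ (pow_pos hε 2), mul_comm]
    exact hM
  refine tendsto_of_tendsto_of_tendsto_of_le_of_le tendsto_const_nhds (by simpa using hE0.div_const (ε ^ 2))
    (fun N => measureReal_nonneg) hbound

end Concentration

/-! ### (v1.2) `a_k(l₁, …, lₙ) = 0` for `k < n` — Lemma 11.3 through the product formula of §13 -/

/-- **`a_k(l₁, …, lₙ) = 0` whenever `k < n`** (genuine loop sequence): by the product structure of §13
(`Factorization.coeffA_append`: `a_k(l, rest) = Σ_{k₁+k₂=k} a_{k₁}((l)) a_{k₂}(rest)`) and Lemma 11.3 (`a₀((l)) = 0` for a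
non-null loop, `coeffA_zero_of_ne_nil`), every vanishing trajectory of an `n`-component sequence has at least `n`
deformations.  (The case `n = 1`, `k = 0` is Lemma 11.3 itself.)
[cite: Chatterjee2019LargeN, Lemma 11.3 («𝒳₀(s) is empty»), §13 (proof of Corollary 3.2: trajectories of (s₁, s₂) are interleavings of trajectories of s₁ and s₂)] -/
theorem coeffA_eq_zero_of_lt_length : ∀ {s : LoopSeq d}, IsLoopSeq s → ∀ {k : ℕ}, k < s.length → coeffA s k = 0
  | [], _, k, hk => absurd hk (Nat.not_lt_zero k)
  | l :: rest, hs, k, hk => by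
    have hl : l ≠ [] := (hs l (by simp)).2
    have hrest : IsLoopSeq rest := fun w hw => hs w (List.mem_cons_of_mem _ hw)
    have h := Factorization.coeffA_append (s₁ := [l]) (s₂ := rest) (fun w hw => by
      simp only [List.mem_cons, List.not_mem_nil, or_false] at hw; exact hw ▸ hl) (fun w hw => (hrest w hw).2) k
    rw [List.singleton_append] at h
    rw [h]
    refine Finset.sum_eq_zero fun kl hkl => ?_
    rw [Finset.HasAntidiagonal.mem_antidiagonal] at hkl
    rcases Nat.eq_zero_or_pos kl.1 with h0 | hpos
    · rw [h0, coeffA_zero_of_ne_nil (fun w hw => by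
        simp only [List.mem_cons, List.not_mem_nil, or_false] at hw; exact hw ▸ hs l (by simp)) (List.cons_ne_nil _ _),
        zero_mul]
    · have hk2 : kl.2 < rest.length := by
        simp only [List.length_cons] at hk
        omega
      rw [coeffA_eq_zero_of_lt_length hrest hk2, mul_zero]

/-! ### (v1.3) The first-order coefficient of a single loop: `|l|·a₁((l)) = #{null ⊖-deformations} − #{null ⊕-deformations}` -/

/-- For a genuine non-null loop `l`, a replacement of the single component by one word `w` is `[w]` or `[]`.
[cite: Chatterjee2019LargeN, §2.2 (deformation of a one-loop sequence; null result deleted)] -/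
theorem replaceAt_singleton_zero (l w : Word d) :
    LoopSeq.replaceAt [l] 0 [w] = if w = [] then [] else [w] := by
  rw [LoopSeq.replaceAt, LoopSeq.prune]
  by_cases h : w = [] <;> simp [h]

/-- `a₀` of a one-word replacement of a single genuine loop: `1` if the word is null, `0` otherwise (Lemma 11.3).
[cite: Chatterjee2019LargeN, Lemma 11.3, §3 (a₀(∅) = 1: the empty trajectory)] -/
theorem coeffA_replaceAt_singleton_zero {l w : Word d} (hw : IsLoopSeq (LoopSeq.replaceAt [l] 0 [w])) :
    coeffA (LoopSeq.replaceAt [l] 0 [w]) 0 = if w = [] then 1 else 0 := by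
  rw [replaceAt_singleton_zero] at hw ⊢
  by_cases h : w = []
  · rw [if_pos h, if_pos h, coeffA_nil_zero]
  · rw [if_neg h] at hw
    rw [if_neg h, if_neg h]
    exact coeffA_zero_of_ne_nil hw (List.cons_ne_nil _ _)

/-- ★ **The first-order coefficient of a single loop**: for a genuine non-null loop `l`,
`|l| · a₁((l)) = #{(x, p) ∈ 𝔻((l)) : l ⊖ₓ p is null} − #{(x, p) ∈ 𝔻((l)) : l ⊕ₓ p is null}` — the first-move recursion
(Corollary 10.4 at `k = 1`) in which every splitting term vanishes (`a₁` of a two-loop sequence is `0`: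
`coeffA_eq_zero_of_lt_length`) and every deformation term is `a₀(s') ∈ {0, 1}` according as the deformed loop is null
(Lemma 11.3).  For the plaquette loop this is the source's «`a₁ = 1`» of §4 once the four null deformations `∂p ⊖ₓ p` are
identified. [cite: Chatterjee2019LargeN, Corollary 10.4 (k = 1), Lemma 11.3, §4 (computation of a₁)] -/
theorem length_mul_coeffA_singleton_one {l : Word d} (hl : IsLoop l) (hne : l ≠ []) :
    (l.length : ℝ) * coeffA [l] 1 =
      ((Finset.univ.filter fun o : DeformIdx [l] => Word.negDeform ([l].get o.1) o.2.1 o.2.2.1 = []).card : ℝ)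
      - ((Finset.univ.filter fun o : DeformIdx [l] => Word.posDeform ([l].get o.1) o.2.1 o.2.2.1 = []).card : ℝ) := by
  classical
  have hs : IsLoopSeq [l] := fun w hw => by
    simp only [List.mem_cons, List.not_mem_nil, or_false] at hw
    exact hw ▸ ⟨hl, hne⟩
  have hlen : 0 < LoopSeq.len [l] := by
    rw [LoopSeq.len_cons, LoopSeq.len_nil, add_zero]
    exact List.length_pos_of_ne_nil hne
  have h := Factorization.len_mul_coeffA (s := [l]) (List.cons_ne_nil _ _) hlen 1
  rw [LoopSeq.len_cons, LoopSeq.len_nil, add_zero, if_pos le_rfl, Nat.sub_self] at h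
  rw [h]
  -- the splitting terms vanish: the results have two components
  have hneg : ∀ o : InvIdx [l], coeffA (LoopSeq.negSplitAt [l] o) 1 = 0 := fun o => by
    refine coeffA_eq_zero_of_lt_length (hs.negSplitAt o) ?_
    have hi : (o.1 : ℕ) = 0 := by have := o.1.isLt; simp only [List.length_singleton] at this; omega
    have h1 := Word.negSplit₁_ne_nil (hs _ (List.get_mem [l] o.1)).1 o.2.2
    have h2 := Word.negSplit₂_ne_nil (hs _ (List.get_mem [l] o.1)).1 o.2.2
    rw [LoopSeq.negSplitAt, hi, LoopSeq.replaceAt, List.take_zero, List.nil_append, zero_add, List.drop_one,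
      List.tail_cons, List.append_nil, LoopSeq.prune_eq_self (s := [_, _]) (fun w hw => by
        simp only [List.mem_cons, List.not_mem_nil, or_false] at hw
        rcases hw with rfl | rfl
        exacts [h1, h2])]
    simp
  have hpos : ∀ o : SameIdx [l], coeffA (LoopSeq.posSplitAt [l] o) 1 = 0 := fun o => by
    refine coeffA_eq_zero_of_lt_length (hs.posSplitAt o) ?_
    have hi : (o.1 : ℕ) = 0 := by have := o.1.isLt; simp only [List.length_singleton] at this; omega
    have h1 := Word.posSplit₁_ne_nil (hs _ (List.get_mem [l] o.1)).1 o.2.2.1 o.2.2.2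
    have h2 := Word.posSplit₂_ne_nil (hs _ (List.get_mem [l] o.1)).1 o.2.2.1 o.2.2.2
    rw [LoopSeq.posSplitAt, hi, LoopSeq.replaceAt, List.take_zero, List.nil_append, zero_add, List.drop_one,
      List.tail_cons, List.append_nil, LoopSeq.prune_eq_self (s := [_, _]) (fun w hw => by
        simp only [List.mem_cons, List.not_mem_nil, or_false] at hw
        rcases hw with rfl | rfl
        exacts [h1, h2])]
    simp
  -- the deformation terms are indicators of null results
  have hD : ∀ o : DeformIdx [l], coeffA (LoopSeq.negDeformAt [l] o) 0
      = if Word.negDeform ([l].get o.1) o.2.1 o.2.2.1 = [] then 1 else 0 := fun o => by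
    have hi : (o.1 : ℕ) = 0 := by have := o.1.isLt; simp only [List.length_singleton] at this; omega
    have h' := hs.negDeformAt o
    rw [LoopSeq.negDeformAt, hi] at h' ⊢
    exact coeffA_replaceAt_singleton_zero h'
  have hP : ∀ o : DeformIdx [l], coeffA (LoopSeq.posDeformAt [l] o) 0
      = if Word.posDeform ([l].get o.1) o.2.1 o.2.2.1 = [] then 1 else 0 := fun o => by
    have hi : (o.1 : ℕ) = 0 := by have := o.1.isLt; simp only [List.length_singleton] at this; omega
    have h' := hs.posDeformAt o
    rw [LoopSeq.posDeformAt, hi] at h' ⊢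
    exact coeffA_replaceAt_singleton_zero h'
  rw [Finset.sum_eq_zero fun o _ => hneg o, Finset.sum_eq_zero fun o _ => hpos o, sub_zero, zero_add]
  simp only [hD, hP, Finset.sum_boole]
end Literature.MathematicalPhysics.QuantumFieldTheory.Chatterjee2019LargeN

end
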